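import Mathlib
import HarnessLib
import Summits.QuantumFields.YangMills.Theses.UVClassRigidity
import Literature.MathematicalPhysics.QuantumFieldTheory.Balaban1983to89.T3TiltDescent
import Literature.MathematicalPhysics.QuantumFieldTheory.Balaban1983to89.T3UnitScaleTilt

/-!
# Birth skeleton (crux A) of route-QuantumFields-UVClassRigidity — D-0145 ideator ym-r3-idea-1 g4, LINE 2
Stubs `stub_*` (sorry) + the kernel-checked composition `LimitTrajectoriesUVEquivalent_of` concluding the ROUTE decl by name.
-/

namespace Summit.QuantumFields.YangMills.Cruxes.LimitTrajectoriesUVEquivalent.UVClassBirth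

open MeasureTheory Filter Topology
open Literature.MathematicalPhysics.QuantumFieldTheory.Balaban1983to89
open Literature.MathematicalPhysics.QuantumFieldTheory.Balaban1983to89.T3ContinuumYM3Torus
open Literature.MathematicalPhysics.QuantumFieldTheory.Balaban1983to89.T3NestedUnitLaws
open Literature.MathematicalPhysics.QuantumFieldTheory.Balaban1983to89.T3UnitLawDensityEML
open Literature.MathematicalPhysics.QuantumFieldTheory.Balaban1983to89.T4Continuum
open Literature.MathematicalPhysics.QuantumFieldTheory.Balaban1983to89.Missing
open Literature.MathematicalPhysics.QuantumFieldTheory.Balaban1983to89.T3TiltDescent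
open Literature.MathematicalPhysics.QuantumFieldTheory.Balaban1983to89.T4GenFunBounds

noncomputable section

/-- `SU(2)` as a type. -/
abbrev SU2 : Type := ↥(Matrix.specialUnitaryGroup (Fin 2) ℂ)

/-- A trajectory of height laws: one measure on the canonical height-`j` configuration space of `F` for every `j`. -/
abbrev Traj (F : T3Family) : Type := (j : ℕ) → Measure (GaugeField (F.P j) 0 SU2)

/-- CONSISTENCY under Bałaban's one-step averaging `descend` (run `j+1`'s first step read on run `j`'s finest lattice). -/
def Consistent (F : T3Family) (μ : Traj F) : Prop :=
  ∀ j : ℕ, IsProbabilityMeasure (μ j) ∧ μ j = Measure.map (descend F ℰp j) (μ (j + 1))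

/-- REALISATION: along the strictly increasing cutoff sequence `θ`, every joint normalised Wilson-loop expectation of the
`(F, γ)` Wilson runs converges to the integral of the unit string observable against the unit law `μ 0`. -/
def Realises (F : T3Family) (γ : ℝ) (θ : ℕ → ℕ) (μ : Traj F) : Prop :=
  StrictMono θ ∧ ∀ os : List (ULoop3 F),
    Tendsto (fun i => (F.scheme ℰp γ).expectAt (θ i) os) atTop
      (𝓝 (∫ u, (os.map fun C => loopAt u (C.1.atLevel 0)).prod ∂(μ 0)))

/-- UV-EQUIVALENCE of two trajectories in the local clustering sense, from height `j₀` on: absolutely continuous height laws with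
densities positive on the small-field set `S_j = {PlaqSmall (δ j)}`, whose LOG-RATIO has (C2) one-bond oscillation `≤ ω j` on `S_j`,
(C3) two-bond second differences `≤ ω j · exp(-κ · dist)` on `S_j` (ℓ¹ torus distance of the bonds' base points, height-`j` lattice
units), and (C4) both give the large-field set mass `≤ η j`. -/
def UVEquiv (F : T3Family) (κ : ℝ) (j₀ : ℕ) (δ ω η : ℕ → ℝ) (μ μ' : Traj F) : Prop :=
  ∀ j : ℕ, j₀ ≤ j → ∃ r r' : GaugeField (F.P j) 0 SU2 → ℝ, Measurable r ∧ Measurable r' ∧ (∀ U, 0 ≤ r U ∧ 0 ≤ r' U) ∧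
    (∀ U, PlaqSmall (δ j) U → 0 < r U ∧ 0 < r' U) ∧
    μ j = (fieldMeasure (F.P j) 0 SU2).withDensity (fun U => ENNReal.ofReal (r U)) ∧
    μ' j = (fieldMeasure (F.P j) 0 SU2).withDensity (fun U => ENNReal.ofReal (r' U)) ∧
    (∀ (b : PBond (F.P j) 0) (U V : GaugeField (F.P j) 0 SU2), PlaqSmall (δ j) U → PlaqSmall (δ j) V →
      (∀ c : PBond (F.P j) 0, c ≠ b → U c = V c) →
      |(Real.log (r U) - Real.log (r' U)) - (Real.log (r V) - Real.log (r' V))| ≤ ω j) ∧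
    (∀ (b b' : PBond (F.P j) 0) (U V W Z : GaugeField (F.P j) 0 SU2), PlaqSmall (δ j) U → PlaqSmall (δ j) V →
      PlaqSmall (δ j) W → PlaqSmall (δ j) Z → (∀ c : PBond (F.P j) 0, c ≠ b → U c = V c) →
      (∀ c : PBond (F.P j) 0, c ≠ b' → U c = W c) → (∀ c : PBond (F.P j) 0, c ≠ b' → V c = Z c) →
      (∀ c : PBond (F.P j) 0, c ≠ b → W c = Z c) →
      |((Real.log (r U) - Real.log (r' U)) - (Real.log (r V) - Real.log (r' V))) -
        ((Real.log (r W) - Real.log (r' W)) - (Real.log (r Z) - Real.log (r' Z)))| ≤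
        ω j * Real.exp (-(κ * (b.src.tdist b'.src : ℝ)))) ∧
    μ j {U | ¬ PlaqSmall (δ j) U} ≤ ENNReal.ofReal (η j) ∧ μ' j {U | ¬ PlaqSmall (δ j) U} ≤ ENNReal.ofReal (η j)

/-! ## BC3 skeleton for crux A `LimitTrajectoriesUVEquivalent` -/

/-- HEIGHTWISE REALISATION along `θ`: the unit clause (`Realises`) AND, at every height `j`, setwise convergence of the
run-`θ i` height-`j` laws `(descendTo j (θ i))_* Gibbs_{θ i}` against bounded measurable test functions. -/
def HeightRealises (F : T3Family) (γ : ℝ) (θ : ℕ → ℕ) (μ : Traj F) : Prop :=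
  Realises F γ θ μ ∧ ∀ (j : ℕ) (g : GaugeField (F.P j) 0 SU2 → ℝ), Measurable g → (∃ M : ℝ, ∀ U, |g U| ≤ M) →
    Tendsto (fun i => if h : j ≤ θ i then
        ∫ U, g (descendTo F ℰp j (θ i) h U) ∂(gibbsMeasure (F.P (θ i)) ((F.scheme ℰp γ).β (θ i)))
      else 0) atTop (𝓝 (∫ V, g V ∂(μ j)))

/-- stub 1 (M/L, soft): HEIGHTWISE COMPACTNESS — every cutoff subsequence has a further subsequence along which the descended run
laws converge setwise at every height to a CONSISTENT trajectory (Banach–Alaoglu in `L^∞(Haar)` per height from the `K`-uniform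
UV-stability density bounds, diagonal subsequence, consistency passes to setwise limits, unit clause from `expectAt_eq_integral_unitLaw`). -/
theorem stub_heightwiseCompactness :
    ∀ (F : T3Family) (γ : ℝ), 0 < γ → ∀ φ : ℕ → ℕ, StrictMono φ →
      ∃ ψ : ℕ → ℕ, StrictMono ψ ∧ ∃ μ : Traj F, Consistent F μ ∧ HeightRealises F γ (φ ∘ ψ) μ := by
  sorry

/-- stub 2 (L/XL, the Bałaban content): UNIFORM UV STRUCTURE — for weak coupling there are class parameters such that ANY two
consistent heightwise-realised trajectories of `(F, γ)` are UV-equivalent (`K`-uniform smallness (46) + clustering + large-field rarity of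
the fluctuation terms at every height, inherited by the heightwise limits). -/
theorem stub_uniformUVStructure :
    ∃ γ₁ : ℝ, 0 < γ₁ ∧ ∀ (F : T3Family) (γ : ℝ), 0 < γ → γ ≤ γ₁ →
      ∃ (κ : ℝ) (j₀ : ℕ) (δ ω η : ℕ → ℝ), 0 < κ ∧ (∀ j, 0 < δ j ∧ 0 ≤ ω j ∧ 0 ≤ η j) ∧ Summable ω ∧ Summable η ∧
        ∀ (θ θ' : ℕ → ℕ) (μ μ' : Traj F), Consistent F μ → Consistent F μ' →
          HeightRealises F γ θ μ → HeightRealises F γ θ' μ' → UVEquiv F κ j₀ δ ω η μ μ' := by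
  sorry

/-- Composition: the two stubs give crux A. -/
theorem LimitTrajectoriesUVEquivalent_of : Summit.QuantumFields.YangMills.Theses.UVClassRigidity.LimitTrajectoriesUVEquivalent := by
  have h1 := stub_heightwiseCompactness
  have h2 := stub_uniformUVStructure
  obtain ⟨γ₁, hγ₁, h2⟩ := h2
  refine ⟨γ₁, hγ₁, fun F γ hγ hle => ?_⟩
  obtain ⟨κ, j₀, δ, ω, η, hκ, hpos, hω, hη, hall⟩ := h2 F γ hγ hle
  refine ⟨κ, j₀, δ, ω, η, hκ, hpos, hω, hη, fun φ φ' hφ hφ' => ?_⟩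
  obtain ⟨ψ, hψ, μ, hc, hr⟩ := h1 F γ hγ φ hφ
  obtain ⟨ψ', hψ', μ', hc', hr'⟩ := h1 F γ hγ φ' hφ'
  exact ⟨ψ, ψ', hψ, hψ', μ, μ', hc, hc', hr.1, hr'.1, hall _ _ μ μ' hc hc' hr hr'⟩


end

end Summit.QuantumFields.YangMills.Cruxes.LimitTrajectoriesUVEquivalent.UVClassBirth
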